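import Mathlib
import HarnessLib
import Literature.MathematicalPhysics.QuantumLattice.TorusFermiWeightSum

/-!
# Route `WeakCouplingBCS`, support item `WcbcsLegendreCeiling` (stmt-HubbardSuperconductivity-1197):
# the Cooper logarithm of the BdG gain, from above

Helper file (`--supports stmt-HubbardSuperconductivity-1197`); real analysis on the momentum grid
`(ℤ/Lℤ)²` of the free band `ε_L(k) = -2Σᵢ cos(2πkᵢ/L)` (`torusBand`). PROVED:

* `bdgGain_le` — the per-mode BdG energy gain `√(ξ² + D²) - |ξ|` of a pairing amplitude `|D| ≤ A h`
  is at most `(2A + A²/2) h²/(2h + |ξ|)` (it is `≤ |D|`, and `≤ D²/(2|ξ|)` away from the level);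
* `exists_sum_bdgGain_le` — **the Cooper logarithm from above**: for `μ` at distance `≥ d₀` from the
  band edge `-4` and the band centre `0`, `0 < h ≤ e⁻¹`, `L ≥ 1/h` and `|D_k| ≤ A h`,
  `Σ_k (√(ξ_k² + D_k²) - |ξ_k|) ≤ C(A, d₀) h² log(1/h) L²`, `ξ_k = ε_L(k) - μ`
  (from the torus Fermi-weight sum `exists_sum_fermiWeight_le` at `β = 1/h`) — the Cooper bubble
  `½N(0) log` of Salmhofer, *Renormalization* (1999) §4.5.4, entering as an UPPER bound on the energy
  gained by the sourced free gas `K_μ - h(Δ_g + Δ_g†)` over the unsourced one (the BdG levels are in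
  `WeakCouplingBCSWcbcsSourcedFreeGasCooperLogBdG.lean`, the shell-level window of the doped Fermi sea in
  `WeakCouplingBCSWcbcsSourcedFreeGasCooperLogFermiSea.lean`).

No definitions; everything is proved.
-/

set_option linter.dupNamespace false

namespace Summit.HubbardSuperconductivity.HubbardSuperconductivity.Theorems

namespace WcbcsLegendre

open Literature.MathematicalPhysics.QuantumLattice Literature.Probability.LatticeModels Finset Real

/-! ### The per-mode BdG gain -/

/-- `√(ξ² + D²) - |ξ| ≤ |D|`. [folklore] -/
theorem sqrt_sq_add_sq_sub_abs_le (ξ D : ℝ) : Real.sqrt (ξ ^ 2 + D ^ 2) - |ξ| ≤ |D| := by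
  have h : Real.sqrt (ξ ^ 2 + D ^ 2) ≤ |ξ| + |D| := by
    rw [Real.sqrt_le_left (by positivity)]
    nlinarith [abs_nonneg ξ, abs_nonneg D, sq_abs ξ, sq_abs D]
  linarith

/-- `0 ≤ √(ξ² + D²) - |ξ|`. [folklore] -/
theorem sqrt_sq_add_sq_sub_abs_nonneg (ξ D : ℝ) : 0 ≤ Real.sqrt (ξ ^ 2 + D ^ 2) - |ξ| := by
  have h : |ξ| ≤ Real.sqrt (ξ ^ 2 + D ^ 2) := by
    rw [← Real.sqrt_sq_eq_abs]
    exact Real.sqrt_le_sqrt (by nlinarith)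
  linarith

/-- `(√(ξ² + D²) - |ξ|) · |ξ| ≤ D²/2` (the gain times `√ + |ξ| ≥ 2|ξ|` is exactly `D²`). [folklore] -/
theorem sqrt_sq_add_sq_sub_abs_mul_abs_le (ξ D : ℝ) :
    (Real.sqrt (ξ ^ 2 + D ^ 2) - |ξ|) * |ξ| ≤ D ^ 2 / 2 := by
  set r := Real.sqrt (ξ ^ 2 + D ^ 2) with hr
  have hr2 : r ^ 2 = ξ ^ 2 + D ^ 2 := Real.sq_sqrt (by positivity)
  have hξr : |ξ| ≤ r := by
    rw [hr, ← Real.sqrt_sq_eq_abs]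
    exact Real.sqrt_le_sqrt (by nlinarith)
  have hprod : (r - |ξ|) * (r + |ξ|) = D ^ 2 := by nlinarith [sq_abs ξ]
  have hg : 0 ≤ r - |ξ| := by linarith
  nlinarith [abs_nonneg ξ]

/-- **The per-mode BdG gain**: for `|D| ≤ A h` (`h > 0`),
`√(ξ² + D²) - |ξ| ≤ (2A + A²/2) h² / (2h + |ξ|)`. [folklore] -/
theorem bdgGain_le {ξ D A h : ℝ} (hh : 0 < h) (hD : |D| ≤ A * h) :
    Real.sqrt (ξ ^ 2 + D ^ 2) - |ξ| ≤ (2 * A + A ^ 2 / 2) * h ^ 2 / (2 * h + |ξ|) := by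
  have hden : 0 < 2 * h + |ξ| := by positivity
  rw [le_div_iff₀ hden]
  have h1 := sqrt_sq_add_sq_sub_abs_le ξ D
  have h2 := sqrt_sq_add_sq_sub_abs_mul_abs_le ξ D
  have h3 := sqrt_sq_add_sq_sub_abs_nonneg ξ D
  have hD2 : D ^ 2 ≤ (A * h) ^ 2 := by
    rw [← sq_abs D]
    exact pow_le_pow_left₀ (abs_nonneg D) hD 2
  nlinarith [abs_nonneg D]

/-! ### The Cooper logarithm from above -/

/-- **Cooper logarithm of the BdG gain, from above.** For `d₀ > 0`, `A ≥ 0` there is `C > 0` such that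
for every `μ` with `μ + 4 ≥ d₀`, `-μ ≥ d₀`, every `0 < h ≤ e⁻¹`, every `L ≥ 1/h` and every family of
pairing amplitudes `|D_k| ≤ A h` on `(ℤ/Lℤ)²`,
`Σ_k (√((ε_L(k) - μ)² + D_k²) - |ε_L(k) - μ|) ≤ C h² log(1/h) L²`.
[cite: Salmhofer1999, §4.5.4, eqs. (4.200)–(4.203)] -/
theorem exists_sum_bdgGain_le {d₀ A : ℝ} (hd₀ : 0 < d₀) (hA : 0 ≤ A) :
    ∃ C : ℝ, 0 < C ∧ ∀ μ : ℝ, d₀ ≤ μ + 4 → d₀ ≤ -μ → ∀ h : ℝ, 0 < h → h ≤ Real.exp (-1) →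
      ∀ (L : ℕ) [NeZero L], 1 / h ≤ (L : ℝ) → ∀ D : TorusSite 2 L → ℝ, (∀ k, |D k| ≤ A * h) →
        ∑ k : TorusSite 2 L, (Real.sqrt ((torusBand L k - μ) ^ 2 + D k ^ 2) - |torusBand L k - μ|) ≤
          C * h ^ 2 * Real.log (1 / h) * (L : ℝ) ^ 2 := by
  obtain ⟨C₀, hC₀, hW⟩ := exists_sum_fermiWeight_le hd₀
  refine ⟨(2 * A + A ^ 2 / 2 + 1) * (2 * C₀ + 8), by positivity, ?_⟩
  intro μ hμ4 hμ0 h hh hhe L _ hL D hD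
  have hLpos : (0 : ℝ) < L := by exact_mod_cast Nat.pos_of_ne_zero (NeZero.ne L)
  -- `β = 1/h ≥ e ≥ 1`, `log β = log(1/h) ≥ 1`
  have hβ1 : 1 ≤ 1 / h := by
    rw [le_div_iff₀ hh, one_mul]
    exact hhe.trans (by
      have := Real.exp_le_one_iff.2 (show (-1 : ℝ) ≤ 0 by norm_num)
      exact this)
  have hlog1 : 1 ≤ Real.log (1 / h) := by
    rw [Real.le_log_iff_exp_le (by positivity), le_div_iff₀ hh]
    calc Real.exp 1 * h ≤ Real.exp 1 * Real.exp (-1) := mul_le_mul_of_nonneg_left hhe (Real.exp_pos _).le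
      _ = 1 := by rw [← Real.exp_add]; norm_num
  have hsum := hW μ hμ4 hμ0 (1 / h) hβ1 L
  -- per-mode domination
  have hmode : ∀ k : TorusSite 2 L,
      Real.sqrt ((torusBand L k - μ) ^ 2 + D k ^ 2) - |torusBand L k - μ| ≤
        (2 * A + A ^ 2 / 2) * h ^ 2 * ((1 / h) / (2 + 1 / h * |torusBand L k - μ|)) := by
    intro k
    have h1 := bdgGain_le (ξ := torusBand L k - μ) hh (hD k)
    have heq : (1 / h) / (2 + 1 / h * |torusBand L k - μ|) = 1 / (2 * h + |torusBand L k - μ|) := by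
      have : 0 < 2 * h + |torusBand L k - μ| := by positivity
      field_simp
    rw [heq]
    calc Real.sqrt ((torusBand L k - μ) ^ 2 + D k ^ 2) - |torusBand L k - μ|
        ≤ (2 * A + A ^ 2 / 2) * h ^ 2 / (2 * h + |torusBand L k - μ|) := h1
      _ = (2 * A + A ^ 2 / 2) * h ^ 2 * (1 / (2 * h + |torusBand L k - μ|)) := by ring
  have hK : 0 ≤ (2 * A + A ^ 2 / 2) * h ^ 2 := by positivity
  calc ∑ k : TorusSite 2 L, (Real.sqrt ((torusBand L k - μ) ^ 2 + D k ^ 2) - |torusBand L k - μ|)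
      ≤ ∑ k : TorusSite 2 L, (2 * A + A ^ 2 / 2) * h ^ 2 * ((1 / h) / (2 + 1 / h * |torusBand L k - μ|)) :=
        Finset.sum_le_sum fun k _ => hmode k
    _ = (2 * A + A ^ 2 / 2) * h ^ 2 * ∑ k : TorusSite 2 L, (1 / h) / (2 + 1 / h * |torusBand L k - μ|) := by
        rw [Finset.mul_sum]
    _ ≤ (2 * A + A ^ 2 / 2) * h ^ 2 * (C₀ * (1 + Real.log (1 / h)) * (L : ℝ) ^ 2 + 8 * (1 / h) * L) :=
        mul_le_mul_of_nonneg_left hsum hK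
    _ ≤ (2 * A + A ^ 2 / 2) * h ^ 2 * ((2 * C₀ + 8) * Real.log (1 / h) * (L : ℝ) ^ 2) := by
        refine mul_le_mul_of_nonneg_left ?_ hK
        -- `1 + log β ≤ 2 log β`, `8βL ≤ 8L² ≤ 8 log β L²`
        have h1 : 1 / h * (L : ℝ) ≤ (L : ℝ) ^ 2 := by nlinarith
        have h2 : (L : ℝ) ^ 2 ≤ Real.log (1 / h) * (L : ℝ) ^ 2 := by nlinarith [sq_nonneg (L : ℝ)]
        have h3 : 0 ≤ C₀ * (L : ℝ) ^ 2 := by positivity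
        nlinarith [h1, h2, h3, hC₀]
    _ ≤ (2 * A + A ^ 2 / 2 + 1) * (2 * C₀ + 8) * h ^ 2 * Real.log (1 / h) * (L : ℝ) ^ 2 := by
        have h1 : 0 ≤ (2 * C₀ + 8) * Real.log (1 / h) * (L : ℝ) ^ 2 * h ^ 2 := by positivity
        nlinarith [h1]

end WcbcsLegendre

end Summit.HubbardSuperconductivity.HubbardSuperconductivity.Theorems
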